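import Literature.AnabelianGeometry.AbsoluteAnabelian.GaloisCyclotomeOpenSubgroup
import Literature.AnabelianGeometry.AbsoluteAnabelian.GaloisCyclotomeAction
import HarnessLib

/-!
# [AbsTopIII] Cor. 1.10 (i)(a): the open-subgroup comparison `μ_{ℚ/ℤ}(H) ≅ μ_{ℚ/ℤ}(G)`, `μ_Ẑ(H) ≅ μ_Ẑ(G)`
# is `H`-EQUIVARIANT (proof-only)

Mochizuki, *Topics in Absolute Anabelian Geometry III*, §1, Cor. 1.10 (i)(a), manuscript p. 42 (lit key
`paper:url-5493eb38cbb7`): "[Thus, the underlying module of `μ_{ℚ/ℤ}(G_k)`, `μ_Ẑ(G_k)` is unaffected by the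
operation of passing from `G_k` to an open subgroup of `G_k`.]", together with the `G_k`-module structure of
`μ_Ẑ(G_k)` ("the cyclotome … `μ_Ẑ(G_k)`", acted on through the cyclotomic character, [AbsAnab] Prop. 1.2.1 (vi)
p. 10: "Galois-equivariant"). [cite: MochizukiAbsTopIII2015, Cor 1.10 (i) p.42]

abc-iut-L4-t17's `GaloisCyclotomeOpenSubgroup.lean` constructs the comparison isomorphisms
`muQZ.restrictOpenEquiv H : μ_{ℚ/ℤ}(H) ≃+ μ_{ℚ/ℤ}(G)` and `muZhat.restrictOpenEquiv H : μ_Ẑ(H) ≃* μ_Ẑ(G)` for an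
open subgroup `H` of a compact group `G` and records «Not here: the `G`- and `H`-equivariance of the comparison
(needs the conjugation action, `GaloisCyclotomeAction.lean`, abc-iut-L4-t1)». THIS FILE (proof-only, no definition)
supplies exactly that: for `h ∈ H`,
* `muQZ.restrictOpen_ofRep` — the comparison on representatives `[u ∈ U'] ↦ [u ∈ U'†]`;
* `osMap_imageOpenSubgroup_conj` — conjugating an open subgroup of `H` by `h` and then viewing it in `G` is
  viewing it in `G` and then conjugating by `h`;
* **`muQZ.restrictOpen_smul`** — `μ_{ℚ/ℤ}(H) → μ_{ℚ/ℤ}(G)` intertwines the conjugation action of `h` on `μ_{ℚ/ℤ}(H)`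
  with that of `h ∈ G` on `μ_{ℚ/ℤ}(G)`; `muQZ.restrictOpenEquiv_smul`, `…_symm_smul`;
* **`muZhat.restrictOpenEquiv_smul`**, `muZhat.restrictOpenEquiv_symm_smul` — the same for `μ_Ẑ`.
So the `H`-module `μ_Ẑ(H)` IS the restriction to `H` of the `G`-module `μ_Ẑ(G)`: e.g. for `G_K ⊆ G_{ℚ_p}` open
(a finite extension `K/ℚ_p`), the cyclotomic character of `G_K` on its own group-theoretic cyclotome is the
restriction of that of `G_{ℚ_p}` (consumer: abc-iut cell, layer L6, node `IUTchII:Cor1.11` B12 `Π`-side, GAP-LEDGER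
G-w5d145-1; seat abc-iut-w5-d145). Classical topological group theory; nothing here bears on [IUTchIII] Cor. 3.12.
-/

noncomputable section

universe u

namespace Literature.AnabelianGeometry.AbsoluteAnabelian

variable {G : Type u} [Group G] [TopologicalSpace G] [IsTopologicalGroup G] [CompactSpace G]
  (H : OpenSubgroup G)

open scoped Classical in
/-- **The comparison map on representatives**: `μ_{ℚ/ℤ}(H) → μ_{ℚ/ℤ}(G)` sends the class `[u ∈ U']` (`U'` open in
`H`, `u ∈ U'`) to the class `[u ∈ U'†]` of the same element in the image `U'† ⊆ G`.
[cite: MochizukiAbsTopIII2015, Cor 1.10 (i) p.42] -/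
theorem muQZ.restrictOpen_ofRep (U' : OpenSubgroup (H : Subgroup G)) (u : (H : Subgroup G)) (hu : u ∈ U')
    (ht : (QuotientGroup.mk (⟨u, hu⟩ : (U' : Subgroup (H : Subgroup G))) :
      TopologicalAbelianization (U' : Subgroup (H : Subgroup G))) ∈
        abelianizationTorsion (U' : Subgroup (H : Subgroup G))) :
    muQZ.restrictOpen H (muQZ.ofRep U' u hu ht) =
      muQZ.ofRep (osMap H U') (u : G) ((coe_mem_osMap_iff H U' u).mpr hu)
        (by
          have h := (torsionCongr (topAbelianizationCongr (osEquiv H U')) ⟨_, ht⟩).2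
          rwa [coe_torsionCongr, topAbelianizationCongr_mk] at h) := by
  unfold muQZ.ofRep
  rw [muQZ.restrictOpen_of]
  congr 2

omit [CompactSpace G] in
/-- Conjugation by `h ∈ H` commutes with the passage from open subgroups of `H` to open subgroups of `G`:
`(h U' h⁻¹)† = h U'† h⁻¹`. [cite: MochizukiAbsTopIII2015, Cor 1.10 (i) p.42] -/
theorem osMap_imageOpenSubgroup_conj (h : (H : Subgroup G)) (U' : OpenSubgroup (H : Subgroup G)) :
    osMap H (imageOpenSubgroup (conjContinuousMulEquiv h) U') =
      imageOpenSubgroup (conjContinuousMulEquiv (h : G)) (osMap H U') := by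
  ext g
  rw [mem_osMap_iff]
  change (∃ hg : g ∈ H, (conjContinuousMulEquiv h).symm ⟨g, hg⟩ ∈ U') ↔
    (conjContinuousMulEquiv (h : G)).symm g ∈ osMap H U'
  rw [mem_osMap_iff]
  have hval : ∀ hg : g ∈ H, (((conjContinuousMulEquiv h).symm ⟨g, hg⟩ : (H : Subgroup G)) : G) =
      (conjContinuousMulEquiv (h : G)).symm g := fun hg => by
    change (((MulAut.conj h).symm ⟨g, hg⟩ : (H : Subgroup G)) : G) = (MulAut.conj (h : G)).symm g
    rw [MulAut.conj_symm_apply, MulAut.conj_symm_apply, Subgroup.coe_mul, Subgroup.coe_mul, Subgroup.coe_inv]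
  constructor
  · rintro ⟨hg, hU⟩
    refine ⟨by rw [← hval hg]; exact SetLike.coe_mem _, ?_⟩
    convert hU using 1
    exact Subtype.ext (hval hg).symm
  · rintro ⟨hg', hU⟩
    have hg : g ∈ H := by
      have h1 : (h : G) * (conjContinuousMulEquiv (h : G)).symm g * (h : G)⁻¹ ∈ H :=
        H.mul_mem (H.mul_mem h.2 hg') (H.inv_mem h.2)
      have h2 : (h : G) * (conjContinuousMulEquiv (h : G)).symm g * (h : G)⁻¹ = g := by
        change (h : G) * ((MulAut.conj (h : G)).symm g) * (h : G)⁻¹ = g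
        rw [MulAut.conj_symm_apply]; group
      rwa [h2] at h1
    refine ⟨hg, ?_⟩
    convert hU using 1
    exact Subtype.ext (hval hg)

open scoped Classical in
/-- **`H`-equivariance of `μ_{ℚ/ℤ}(H) → μ_{ℚ/ℤ}(G)`**: the comparison intertwines the conjugation action of
`h ∈ H` on `μ_{ℚ/ℤ}(H)` with the conjugation action of `h`, viewed in `G`, on `μ_{ℚ/ℤ}(G)`.
[cite: MochizukiAbsTopIII2015, Cor 1.10 (i) p.42] -/
theorem muQZ.restrictOpen_smul (h : (H : Subgroup G)) (z : muQZ (H : Subgroup G)) :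
    muQZ.restrictOpen H (h • z) = (h : G) • muQZ.restrictOpen H z := by
  obtain ⟨U', u, hu, ht, rfl⟩ := muQZ.exists_ofRep z
  rw [muQZ.smul_ofRep, muQZ.restrictOpen_ofRep, muQZ.restrictOpen_ofRep]
  conv_rhs => rw [muQZ.smul_ofRep (h : G) (osMap H U') (u : G)]
  refine muQZ.ofRep_congr (osMap_imageOpenSubgroup_conj H h U') ?_
  change (((MulAut.conj h) u : (H : Subgroup G)) : G) = (MulAut.conj (h : G)) (u : G)
  rw [MulAut.conj_apply, MulAut.conj_apply, Subgroup.coe_mul, Subgroup.coe_mul, Subgroup.coe_inv]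

open scoped Classical in
/-- `H`-equivariance of the comparison isomorphism `μ_{ℚ/ℤ}(H) ≃+ μ_{ℚ/ℤ}(G)`.
[cite: MochizukiAbsTopIII2015, Cor 1.10 (i) p.42] -/
theorem muQZ.restrictOpenEquiv_smul (h : (H : Subgroup G)) (z : muQZ (H : Subgroup G)) :
    muQZ.restrictOpenEquiv H (h • z) = (h : G) • muQZ.restrictOpenEquiv H z := by
  rw [muQZ.restrictOpenEquiv_apply, muQZ.restrictOpenEquiv_apply, muQZ.restrictOpen_smul]

open scoped Classical in
/-- `H`-equivariance of the inverse comparison `μ_{ℚ/ℤ}(G) ≃+ μ_{ℚ/ℤ}(H)`: for `g ∈ H`, restricting the `G`-action to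
`H`. [cite: MochizukiAbsTopIII2015, Cor 1.10 (i) p.42] -/
theorem muQZ.restrictOpenEquiv_symm_smul (h : (H : Subgroup G)) (z : muQZ G) :
    (muQZ.restrictOpenEquiv H).symm ((h : G) • z) = h • (muQZ.restrictOpenEquiv H).symm z := by
  apply (muQZ.restrictOpenEquiv H).injective
  rw [AddEquiv.apply_symm_apply, muQZ.restrictOpenEquiv_smul, AddEquiv.apply_symm_apply]

open scoped Classical in
/-- **`H`-equivariance of `μ_Ẑ(H) ≃* μ_Ẑ(G)`**: the `H`-module `μ_Ẑ(H)` is the restriction to `H` of the `G`-module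
`μ_Ẑ(G)` along the open-subgroup comparison (e.g. the cyclotomic character of `G_K` on `μ_Ẑ(G_K)` is the restriction
of that of `G_{ℚ_p}` for `K/ℚ_p` finite). [cite: MochizukiAbsTopIII2015, Cor 1.10 (i) p.42] -/
theorem muZhat.restrictOpenEquiv_smul (h : (H : Subgroup G)) (ζ : muZhat (H : Subgroup G)) :
    muZhat.restrictOpenEquiv H (h • ζ) = (h : G) • muZhat.restrictOpenEquiv H ζ := by
  refine Subtype.ext (funext fun n => ?_)
  rw [muZhat.coe_smul_apply, muZhat.coe_restrictOpenEquiv_apply, muZhat.coe_restrictOpenEquiv_apply,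
    muZhat.coe_smul_apply, muQZ.toAdd_smul, muQZ.restrictOpen_smul]
  apply Multiplicative.toAdd.injective
  rw [toAdd_ofAdd, muQZ.toAdd_smul, toAdd_ofAdd]

open scoped Classical in
/-- `H`-equivariance of the inverse comparison `μ_Ẑ(G) ≃* μ_Ẑ(H)` (restriction of the `G`-action to `H`).
[cite: MochizukiAbsTopIII2015, Cor 1.10 (i) p.42] -/
theorem muZhat.restrictOpenEquiv_symm_smul (h : (H : Subgroup G)) (ξ : muZhat G) :
    (muZhat.restrictOpenEquiv H).symm ((h : G) • ξ) = h • (muZhat.restrictOpenEquiv H).symm ξ := by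
  apply (muZhat.restrictOpenEquiv H).injective
  rw [MulEquiv.apply_symm_apply, muZhat.restrictOpenEquiv_smul, MulEquiv.apply_symm_apply]

end Literature.AnabelianGeometry.AbsoluteAnabelian

end
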